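import Mathlib
import Summits.ValiantsHypothesis.ValiantsHypothesis.Theorems.BarrierLeverPartitionMinorsHitByVPHiddenStatesTwoLayerWitness

/-!
# Route BarrierLever — item `PartitionMinorsHitByVP` (stmt-ValiantsHypothesis-19717), line `hidden-states`:
# GENERIC GOODNESS of a join family (symbolic table) and the SYMBOLIC SPLIT THEOREM — the kernel form of the fitting criterion F⁺

Helper file (`--supports stmt-ValiantsHypothesis-19717`; cell valiant-natproofs, rung V4, 𝒟-side door (c), registered line
`Cruxes/PartitionMinorsHitByVP/Lines/hidden_states.lean` v2, lane `stub_universalJoinWide`; prover seat val-np-p3 gen 10).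
Bookkeeping `def`s (`Var`, `symPoint`, `symMat`, `symDet`, `xi`, `cutSubst`); GENERIC GOODNESS of `(u, e)` means `symDet u e ≠ 0`. Closes NO item.

THE POINT. Every stub of the line ends in `∃ tx, det [∏_{a∈u i}(tx p none a + Σ_{q∈J} tx p (some q) a)]_{i,(p,J)=e k} ≠ 0`. Replace the table by
INDETERMINATES `X_{(p,o,a)}`: the determinant becomes a polynomial `symDet u e ∈ ℂ[X]`, and (`symGood_iff_exists_table`) it is nonzero iff some
complex table works. In this generic language ("generically good" = `symDet u e ≠ 0`) the recursive fitting criterion of memo val-np-p3 g10 §10 is an honest theorem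
(`symGood_of_split`): fix a coordinate `x` and cut constants `β_p, γ_{p,q}`; SPECIALISE the `x`-row of the symbolic table to them
(`X_{(p,none,x)} ↦ β_p`, `X_{(p,some q,x)} ↦ γ_{p,q}`) — the hidden point of column `(p,J)` then has `x`-coordinate the constant
`ξ = β_p + Σ_{q∈J} γ_{p,q}`, rows containing `x` vanish on the columns with `ξ = 0`, and the specialised determinant is block-triangular:
`± (∏ ξ) · symDet(deletion rows, ξ = 0 columns) · symDet(link rows with x erased, ξ ≠ 0 columns)`. Since `ℂ[X]` is a domain, generic goodness
of the two sub-configurations (which SHARE the remaining indeterminates — this is why the numeric `∃ tx` forms do not compose but the symbolic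
ones do) gives generic goodness of the whole. Base case `symGood_of_lonely`: columns in pairwise distinct pieces are generically good for every
injective `u` (zeta table). Together: every F⁺ certificate (a tree of cuts found by `lab/fitting2.py`) is a kernel proof of
`∃ tx, det ≠ 0` by `symGood_of_split` / `symGood_of_lonely` / `exists_table_of_symGood`, and a universal fitting theorem would prove the node.

WHAT THIS IS NOT: no family is certified here; item 19717 OPEN; nothing on crux 14610 or VP ≠ VNP.
-/

set_option linter.dupNamespace false

namespace Summit.ValiantsHypothesis.ValiantsHypothesis.Theorems.BarrierLever.HiddenStates

open Finset Matrix MvPolynomial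

noncomputable section

namespace SymbJoin

variable {h m K r : ℕ}

/-! ## 1. The symbolic table and generic goodness -/

/-- Indeterminates of the symbolic table: one per (piece, base-or-state, coordinate). -/
abbrev Var (m K h : ℕ) := Fin m × Option (Fin K) × Fin h

/-- The `a`-coordinate of the hidden point of column `k`: `X_{(p,none,a)} + Σ_{q ∈ J} X_{(p,some q,a)}`, `(p,J) = e k`. -/
def symPoint (e : Fin r → Fin m × Finset (Fin K)) (k : Fin r) (a : Fin h) : MvPolynomial (Var m K h) ℂ :=
  X ((e k).1, none, a) + ∑ q ∈ (e k).2, X ((e k).1, some q, a)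

/-- The symbolic block-additive matrix. -/
def symMat (u : Fin r → Finset (Fin h)) (e : Fin r → Fin m × Finset (Fin K)) :
    Matrix (Fin r) (Fin r) (MvPolynomial (Var m K h) ℂ) :=
  Matrix.of fun i k => ∏ a ∈ u i, symPoint e k a

/-- The symbolic determinant. -/
def symDet (u : Fin r → Finset (Fin h)) (e : Fin r → Fin m × Finset (Fin K)) : MvPolynomial (Var m K h) ℂ :=
  (symMat u e).det

/-- Evaluating the symbolic determinant at a table gives the numeric determinant. -/
theorem eval_symDet (u : Fin r → Finset (Fin h)) (e : Fin r → Fin m × Finset (Fin K))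
    (tx : Fin m → Option (Fin K) → Fin h → ℂ) :
    MvPolynomial.eval (fun v : Var m K h => tx v.1 v.2.1 v.2.2) (symDet u e)
      = (Matrix.of fun i k : Fin r =>
          ∏ a ∈ u i, (tx (e k).1 none a + ∑ q ∈ (e k).2, tx (e k).1 (some q) a)).det := by
  rw [symDet, RingHom.map_det]
  congr 1
  ext i k
  simp [symMat, symPoint, map_prod, map_sum]

/-- **Generic ⇒ numeric**: a generically good configuration has a good complex table. -/
theorem exists_table_of_symGood (u : Fin r → Finset (Fin h)) (e : Fin r → Fin m × Finset (Fin K)) (hG : symDet u e ≠ 0) :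
    ∃ tx : Fin m → Option (Fin K) → Fin h → ℂ,
      (Matrix.of fun i k : Fin r =>
        ∏ a ∈ u i, (tx (e k).1 none a + ∑ q ∈ (e k).2, tx (e k).1 (some q) a)).det ≠ 0 := by
  by_contra hno
  push Not at hno
  apply hG
  haveI : Infinite ℂ := Infinite.of_injective ((↑) : ℕ → ℂ) Nat.cast_injective
  refine MvPolynomial.funext fun pt => ?_
  rw [map_zero]
  have h1 := eval_symDet u e (fun p o a => pt (p, o, a))
  have hpt : (fun v : Var m K h => (fun p o a => pt (p, o, a)) v.1 v.2.1 v.2.2) = pt := by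
    funext v; rfl
  rw [hpt] at h1
  rw [h1]
  exact hno (fun p o a => pt (p, o, a))

/-- **Numeric ⇒ generic**: a good table makes the configuration generically good. -/
theorem symGood_of_table (u : Fin r → Finset (Fin h)) (e : Fin r → Fin m × Finset (Fin K))
    (tx : Fin m → Option (Fin K) → Fin h → ℂ)
    (htx : (Matrix.of fun i k : Fin r =>
        ∏ a ∈ u i, (tx (e k).1 none a + ∑ q ∈ (e k).2, tx (e k).1 (some q) a)).det ≠ 0) :
    symDet u e ≠ 0 := by
  intro hD
  apply htx
  rw [← eval_symDet, show symDet u e = 0 from hD, map_zero]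

/-- Generic goodness is exactly the `∃ tx` form used by the line's stubs. -/
theorem symGood_iff_exists_table (u : Fin r → Finset (Fin h)) (e : Fin r → Fin m × Finset (Fin K)) :
    symDet u e ≠ 0 ↔ ∃ tx : Fin m → Option (Fin K) → Fin h → ℂ,
      (Matrix.of fun i k : Fin r =>
        ∏ a ∈ u i, (tx (e k).1 none a + ∑ q ∈ (e k).2, tx (e k).1 (some q) a)).det ≠ 0 :=
  ⟨exists_table_of_symGood u e, fun ⟨tx, htx⟩ => symGood_of_table u e tx htx⟩

/-! ## 2. Base case: columns in pairwise distinct pieces (lonely columns) are generically free points -/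

/-- **Base case.** If no two columns share a piece and `u` is injective, the configuration is generically good
(zeta table: the hidden point of column `k` is the indicator vector of `u k`). -/
theorem symGood_of_lonely (u : Fin r → Finset (Fin h)) (hu : Function.Injective u) (e : Fin r → Fin m × Finset (Fin K))
    (hl : Function.Injective fun k => (e k).1) : symDet u e ≠ 0 := by
  classical
  -- the table: piece p carries, on its base, the indicator of the row of its unique column; states carry 0
  let tx : Fin m → Option (Fin K) → Fin h → ℂ := fun p o a =>
    match o with
    | none => if hk : ∃ k, (e k).1 = p then (if a ∈ u hk.choose then 1 else 0) else 0
    | some _ => 0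
  refine symGood_of_table u e tx ?_
  have hpt : ∀ k a, tx (e k).1 none a + ∑ q ∈ (e k).2, tx (e k).1 (some q) a = if a ∈ u k then 1 else 0 := by
    intro k a
    have hex : ∃ k', (e k').1 = (e k).1 := ⟨k, rfl⟩
    have hch : hex.choose = k := hl hex.choose_spec
    simp only [tx, dif_pos hex, hch, Finset.sum_const_zero, add_zero]
  have hentry : ∀ i k, ∏ a ∈ u i, (tx (e k).1 none a + ∑ q ∈ (e k).2, tx (e k).1 (some q) a)
      = if u i ⊆ u k then 1 else 0 := by
    intro i k
    simp_rw [hpt k]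
    rw [Finset.prod_boole]
    by_cases hsub : u i ⊆ u k
    · rw [if_pos hsub, if_pos (fun a ha => hsub ha)]
    · rw [if_neg hsub, if_neg (fun hall => hsub (fun a ha => hall a ha))]
  intro hdet
  obtain ⟨α, hαne, hαmul⟩ := Matrix.exists_mulVec_eq_zero_iff.mpr hdet
  apply hαne
  let col : Fin r → (Fin r → ℂ) := fun k i =>
    ∏ a ∈ u i, (tx (e k).1 none a + ∑ q ∈ (e k).2, tx (e k).1 (some q) a)
  have hzeta : ∀ k ∈ (Finset.univ : Finset (Fin r)), ∀ k' ∈ (Finset.univ : Finset (Fin r)),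
      col k' (id k) = if u k ⊆ u k' then 1 else 0 := fun k _ k' _ => hentry k k'
  have hsum : ∑ k, α k • col k = 0 := by
    funext i
    have := congrFun hαmul i
    rw [Matrix.mulVec, dotProduct] at this
    simp only [Matrix.of_apply, Pi.zero_apply] at this
    rw [Finset.sum_apply, Pi.zero_apply]
    simpa [col, Pi.smul_apply, smul_eq_mul, mul_comm] using this
  funext k
  exact TwoLayer.eq_zero_of_zeta u hu col Finset.univ id hzeta α (fun k hk => absurd (Finset.mem_univ k) hk) hsum k

/-! ## 3. The symbolic split theorem -/

/-- The cut constant `ξ_k = β_p + Σ_{q ∈ J} γ_{p,q}` of column `k`, `(p, J) = e k`. -/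
def xi (e : Fin r → Fin m × Finset (Fin K)) (β : Fin m → ℂ) (γ : Fin m → Fin K → ℂ) (k : Fin r) : ℂ :=
  β (e k).1 + ∑ q ∈ (e k).2, γ (e k).1 q

/-- The specialisation of the `x`-row of the symbolic table to the cut constants. -/
def cutSubst (x : Fin h) (β : Fin m → ℂ) (γ : Fin m → Fin K → ℂ) :
    MvPolynomial (Var m K h) ℂ →ₐ[ℂ] MvPolynomial (Var m K h) ℂ :=
  MvPolynomial.aeval fun v : Var m K h =>
    if v.2.2 = x then (match v.2.1 with
      | none => C (β v.1)
      | some q => C (γ v.1 q))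
    else X v

/-- Off the cut coordinate the specialisation does nothing to a hidden point. -/
theorem cutSubst_symPoint_ne (x : Fin h) (β : Fin m → ℂ) (γ : Fin m → Fin K → ℂ) (e : Fin r → Fin m × Finset (Fin K))
    (k : Fin r) (a : Fin h) (ha : a ≠ x) : cutSubst x β γ (symPoint e k a) = symPoint e k a := by
  simp [cutSubst, symPoint, ha, map_sum]

/-- At the cut coordinate the hidden point becomes the constant `ξ_k`. -/
theorem cutSubst_symPoint_eq (x : Fin h) (β : Fin m → ℂ) (γ : Fin m → Fin K → ℂ) (e : Fin r → Fin m × Finset (Fin K))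
    (k : Fin r) : cutSubst x β γ (symPoint e k x) = C (xi e β γ k) := by
  simp [cutSubst, symPoint, xi, map_sum]

/-- The specialised entry: `ξ_k^{[x ∈ u i]} · ∏_{a ∈ u i, a ≠ x} symPoint`. -/
theorem cutSubst_entry (x : Fin h) (β : Fin m → ℂ) (γ : Fin m → Fin K → ℂ) (u : Fin r → Finset (Fin h))
    (e : Fin r → Fin m × Finset (Fin K)) (i k : Fin r) :
    cutSubst x β γ (∏ a ∈ u i, symPoint e k a)
      = (if x ∈ u i then C (xi e β γ k) else 1) * ∏ a ∈ (u i).erase x, symPoint e k a := by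
  classical
  rw [map_prod]
  by_cases hx : x ∈ u i
  · rw [if_pos hx, ← Finset.mul_prod_erase (u i) _ hx, cutSubst_symPoint_eq]
    congr 1
    exact Finset.prod_congr rfl fun a ha => cutSubst_symPoint_ne x β γ e k a (Finset.ne_of_mem_erase ha)
  · rw [if_neg hx, one_mul, Finset.erase_eq_of_notMem hx]
    exact Finset.prod_congr rfl fun a ha => cutSubst_symPoint_ne x β γ e k a (fun h' => hx (h' ▸ ha))

/-- **THE SYMBOLIC SPLIT THEOREM (engine of the fitting criterion F⁺).** Fix a coordinate `x` and cut constants `β, γ` with cut values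
`ξ_k`. Sort the rows into those avoiding `x` (via `er ∘ inl`) and those containing `x` (`er ∘ inr`), and the columns into `ξ = 0`
(`ec ∘ inl`) and `ξ ≠ 0` (`ec ∘ inr`), with equal block sizes `r₀`, `r₁`. If the DELETION configuration (rows avoiding `x`, columns with
`ξ = 0`) and the LINK configuration (rows containing `x` with `x` erased, columns with `ξ ≠ 0`) are generically good, so is the whole. -/
theorem symGood_of_split {r₀ r₁ : ℕ} (u : Fin r → Finset (Fin h)) (e : Fin r → Fin m × Finset (Fin K)) (x : Fin h)
    (β : Fin m → ℂ) (γ : Fin m → Fin K → ℂ) (er ec : Fin r₀ ⊕ Fin r₁ ≃ Fin r)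
    (hrow0 : ∀ j, x ∉ u (er (Sum.inl j))) (hrow1 : ∀ j, x ∈ u (er (Sum.inr j)))
    (hcol0 : ∀ j, xi e β γ (ec (Sum.inl j)) = 0) (hcol1 : ∀ j, xi e β γ (ec (Sum.inr j)) ≠ 0)
    (h0 : symDet (fun j : Fin r₀ => u (er (Sum.inl j))) (fun j => e (ec (Sum.inl j))) ≠ 0)
    (h1 : symDet (fun j : Fin r₁ => (u (er (Sum.inr j))).erase x) (fun j => e (ec (Sum.inr j))) ≠ 0) :
    symDet u e ≠ 0 := by
  classical
  intro hD
  set Φ := cutSubst (m := m) (K := K) x β γ with hΦ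
  -- the specialised matrix, reindexed, is block upper-triangular
  set M' : Matrix (Fin r) (Fin r) (MvPolynomial (Var m K h) ℂ) := Φ.toRingHom.mapMatrix (symMat u e) with hM'
  set A : Matrix (Fin r₀) (Fin r₀) (MvPolynomial (Var m K h) ℂ) :=
    symMat (fun j : Fin r₀ => u (er (Sum.inl j))) (fun j => e (ec (Sum.inl j))) with hA
  set D' : Matrix (Fin r₁) (Fin r₁) (MvPolynomial (Var m K h) ℂ) :=
    symMat (fun j : Fin r₁ => (u (er (Sum.inr j))).erase x) (fun j => e (ec (Sum.inr j))) with hD'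
  set Dg : Matrix (Fin r₁) (Fin r₁) (MvPolynomial (Var m K h) ℂ) :=
    Matrix.diagonal fun j => C (xi e β γ (ec (Sum.inr j))) with hDg
  have hblock : M'.submatrix er ec = Matrix.fromBlocks A
      (Matrix.of fun j j' => ∏ a ∈ u (er (Sum.inl j)), symPoint e (ec (Sum.inr j')) a) 0 (D' * Dg) := by
    apply Matrix.ext
    intro i k
    rw [Matrix.submatrix_apply, hM', RingHom.mapMatrix_apply, Matrix.map_apply]
    simp only [symMat, Matrix.of_apply, AlgHom.toRingHom_eq_coe, RingHom.coe_coe]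
    rw [cutSubst_entry]
    rcases i with j | j <;> rcases k with j' | j'
    · simp only [Matrix.fromBlocks_apply₁₁, if_neg (hrow0 j), one_mul, Finset.erase_eq_of_notMem (hrow0 j), hA, symMat,
        Matrix.of_apply]
      rfl
    · simp only [Matrix.fromBlocks_apply₁₂, if_neg (hrow0 j), one_mul, Finset.erase_eq_of_notMem (hrow0 j), Matrix.of_apply]
    · simp only [Matrix.fromBlocks_apply₂₁, if_pos (hrow1 j), hcol0 j', MvPolynomial.C_0, zero_mul, Matrix.zero_apply]
    · simp only [Matrix.fromBlocks_apply₂₂, if_pos (hrow1 j), hD', hDg, symMat, Matrix.mul_diagonal, Matrix.of_apply]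
      rw [mul_comm]
      rfl
  -- determinant of the specialised matrix
  have hdetM' : M'.det = 0 := by
    rw [hM', ← RingHom.map_det, show (symMat u e).det = symDet u e from rfl, hD, map_zero]
  have hdet_sub : (M'.submatrix er ec).det = 0 := by
    have : M'.submatrix er ec = (M'.submatrix er er).submatrix id (ec.trans er.symm) := by
      ext i k; simp
    rw [this, Matrix.det_permute', Matrix.det_submatrix_equiv_self, hdetM', mul_zero]
  rw [hblock, Matrix.det_fromBlocks_zero₂₁, Matrix.det_mul, hDg, Matrix.det_diagonal] at hdet_sub
  -- each factor is nonzero in the domain ℂ[X]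
  have hA0 : A.det ≠ 0 := h0
  have hD0 : D'.det ≠ 0 := h1
  have hxi : ∏ j : Fin r₁, C (xi e β γ (ec (Sum.inr j))) ≠ (0 : MvPolynomial (Var m K h) ℂ) :=
    Finset.prod_ne_zero_iff.mpr fun j _ h0 => hcol1 j (MvPolynomial.C_eq_zero.mp h0)
  exact (mul_ne_zero hA0 (mul_ne_zero hD0 hxi)) hdet_sub

end SymbJoin

end

end Summit.ValiantsHypothesis.ValiantsHypothesis.Theorems.BarrierLever.HiddenStates
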